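import Literature.AnabelianGeometry.EtaleTheta.Discharge.Sec5Thm57CoherentFamilyOfRebase

/-!
# [EtTh] §5, Theorem 5.7 final knit, FILE 2 — ANCHORED form: the root binder `hroot` and Prop. 4.2 (iv) `hivP'` asked ONLY at the
# discrepancy unit `u₁` of a NORMALISED ANCHOR `(α₁, β₁, u₁)` (pp. 318–319, 329–330 / PDF pp. 92–93, 103–104)

Mochizuki, *The étale theta function …*, Publ. RIMS **45** (2009) [cite: MochizukiEtTh2009, Thm 5.7 p.329–330 (PDF pp.103–104);
Thm 5.6 proof p.329 (PDF p.103) (the unit "`u ∈ O^×(T₂)`"); Rmk 4.3.2 p.318–319 (PDF pp.92–93); Prop 4.2 (iv) p.315 (PDF p.89);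
Lem 5.8 p.331 (PDF p.105)].  abc-iut cell, layer L2, EtTh:Thm5.7 census row «`hroot₁N`/`hfix` [f-123]» (abc-iut-L2-lead ROWS #57
R503/R504: «take the hroot clause ONLY for the discrepancy unit `u` of the normalised transport … in the per-(u₁,N) shape»).
Seat abc-iut-f-123 (gen 4).  PROOF-ONLY (0 definitions): a TWIN of abc-iut-w5-d245's `hfam_of_rebase` /
`hfam_ofConnectedTemperoidFamily_of_rebase` (p445776, `Sec5Thm57CoherentFamilyOfRebase.lean`) — same statement, same proof (abc-iut-f-121's
`NthRoot.exists_coherent_family_member_rebase` at the rebased root) — in which the two per-unit binders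
* `hroot` (a unit `ũ ∈ O^×(B_N)` over `u₁` along `β_{1,N}` with its power law and saturation — Lem. 5.8 / Def. 4.1 (iii)) and
* `hivP'` (Prop. 4.2 (iv) at the `u₁`-twisted level-1 pair)
are quantified NOT over every unit `u₁ ∈ O^×(B_1)` but only over the units `u₁` of NORMALISED ANCHORS `(α₁, β₁, u₁)` at the first root
(`α₁⁻¹ ≫ Ψ(s^⊓_1) ≫ β₁ = s^⊓_1`, `α₁⁻¹ ≫ Ψ(s^⊔_1) ≫ β₁ = s^⊔_1 ≫ u₁`) — the discrepancy unit "`u`" of the proof of Thm. 5.6 (p.329), which is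
the only unit at which the family `hfam` consumes them (the original proof reads `hroot u₁ hu₁ N` after introducing the anchor).  With
abc-iut-f-123's `BiKummerSetting.NthRoot.hroot₁N_clause_iff` (p455663) the anchored `hroot` is supplied from the anchored pointwise pair
(Lemma 5.8 at `u₁` read on `B_N`; `H_{A_N}`-fixedness of the unit's function) — see the `_final_v3` interface of the EtTh:Thm5.7 closer.
HONEST FRAMING: kernel-checked implication for data so parametrised (the class `TemperedFrobenioid T₀ (ConnectedPart (BTemp X.Pi)) VD` is
not shown inhabited here); nothing asserts any result of [EtTh] unconditionally; typed ≠ discharged; no side taken on [IUTchIII] Cor. 3.12.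
-/

noncomputable section

namespace Literature.AnabelianGeometry.EtaleTheta

open CategoryTheory Opposite Literature.AlgebraicGeometry.Frobenioids Literature.AnabelianGeometry.SemiGraphs
  Literature.AnabelianGeometry.SemiGraphs.GaloisObjects

universe u₀ v₀ w

namespace ThetaFrobenioidTower

variable {K : Type u₀} [Field K] {X : SemiGraphs.TemperedArithmeticGroup.{u₀} K} {D₀ : Type u₀} [Category.{v₀} D₀]
  {V : FrdIMonoidStub.{w}} {T₀ : RealifiedDivisorMonoids (D₀ := D₀) V}
  {VD : FrdICatStub.{u₀ + 1, u₀, w} (ConnectedPart (BTemp X.Pi))}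
  {tf : TemperedFrobenioid T₀ (ConnectedPart (BTemp X.Pi)) VD} {hZ : tf.monoidType = MonoidType.Z}
  {hP : ∀ A : (ConnectedPart (BTemp X.Pi))ᵒᵖ, IsPerfect (tf.Φ.carrier A)}
  {NH : Subgroup (Field.absoluteGaloisGroup K) → tf.category → ℕ+ → Prop}
  {E : Set ℕ+} (𝒯 : ThetaEnvTower.{max u₀ w} E) (ιX : 𝒯.PiX ≃ₜ* X.Pi)
  {pullFrac : ∀ {A A' : (BiKummerSetting.mkOfConnectedTemperoidYddTower X tf hZ hP NH 𝒯 ιX).C} (_ : A' ⟶ A),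
    (BiKummerSetting.mkOfConnectedTemperoidYddTower X tf hZ hP NH 𝒯 ιX).biratUnits A →
      (BiKummerSetting.mkOfConnectedTemperoidYddTower X tf hZ hP NH 𝒯 ιX).biratUnits A'}
  {lv : ℕ+}
  {θ : (BiKummerSetting.mkOfConnectedTemperoidYddTower X tf hZ hP NH 𝒯 ιX).biratUnits
    (BiKummerSetting.mkOfConnectedTemperoidYddTower X tf hZ hP NH 𝒯 ιX).Aodot}
  {Bl : (BiKummerSetting.mkOfConnectedTemperoidYddTower X tf hZ hP NH 𝒯 ιX).C}
  {Pl : (BiKummerSetting.mkOfConnectedTemperoidYddTower X tf hZ hP NH 𝒯 ιX).FractionPair θ Bl}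
  {Rl : (BiKummerSetting.mkOfConnectedTemperoidYddTower X tf hZ hP NH 𝒯 ιX).NthRoot θ Pl lv pullFrac}
  (h : ModelFrobenioid.Hypotheses tf.divisorMonoid tf.ratFnFunctor)
  (Q : FrobenioidTheta.ThetaSubquotientStub.{w} (ConnectedPart (BTemp X.Pi))) (odd_l : Odd (lv : ℕ))
  (R : ∀ N : ℕ+, (BiKummerSetting.mkOfConnectedTemperoidYddTower X tf hZ hP NH 𝒯 ιX).NthRoot Rl.root Rl.pair N pullFrac)
  (K' : Type w) [Field K'] {X₀ : ConnectedPart (BTemp X.Pi)}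
  (t : ∀ N : ℕ+, (R N).BN.base ⟶ X₀)
  (c₀ : K'ˣ →* (tf.ratFnFunctor.obj (op X₀))ˣ)
  (hinj : ∀ N : ℕ+, Function.Injective ((Units.map (tf.ratFnFunctor.map (t N).op).hom).comp c₀))
  (hinvc : ∀ (N : ℕ+) (g : Aut (R N).AN.base),
    pull tf.divisorMonoid g.hom (ModelFrobenioid.div (R N).pair.num) = ModelFrobenioid.div (R N).pair.num)
  (hinvp : ∀ (N : ℕ+) (y : 𝒯.PiX), y ∈ 𝒯.PiYdd →
    pull tf.divisorMonoid ((BiKummerSetting.mkOfConnectedTemperoidYddTower X tf hZ hP NH 𝒯 ιX).galoisSurj (R N).AN.base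
      (R N).αData.isGalois (ιX y)).hom (ModelFrobenioid.div (R N).pair.den) = ModelFrobenioid.div (R N).pair.den)
  (α : ∀ {N N' : ℕ+}, (N : ℕ) ∣ N' → ((R N').AN ⟶ (R N).AN))
  (β : ∀ {N N' : ℕ+}, (N : ℕ) ∣ N' → ((R N').BN ⟶ (R N).BN))
  (comm_sCap : ∀ {N N' : ℕ+} (hd : (N : ℕ) ∣ N'), (R N').pair.num ≫ β hd = α hd ≫ (R N).pair.num)
  (comm_sCup : ∀ {N N' : ℕ+} (hd : (N : ℕ) ∣ N'), (R N').pair.den ≫ β hd = α hd ≫ (R N).pair.den)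
  (isIsometry_α : ∀ {N N' : ℕ+} (hd : (N : ℕ) ∣ N'),
    ((BiKummerSetting.mkOfConnectedTemperoidYddTower X tf hZ hP NH 𝒯 ιX).sec5Stub h).pre.IsIsometry (α hd))
  (degFr_α : ∀ {N N' : ℕ+} (hd : (N : ℕ) ∣ N'),
    (((BiKummerSetting.mkOfConnectedTemperoidYddTower X tf hZ hP NH 𝒯 ιX).sec5Stub h).pre.degFr (α hd) : ℕ) * N = N')
  (isIsometry_β : ∀ {N N' : ℕ+} (hd : (N : ℕ) ∣ N'),
    ((BiKummerSetting.mkOfConnectedTemperoidYddTower X tf hZ hP NH 𝒯 ιX).sec5Stub h).pre.IsIsometry (β hd))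
  (degFr_β : ∀ {N N' : ℕ+} (hd : (N : ℕ) ∣ N'),
    (((BiKummerSetting.mkOfConnectedTemperoidYddTower X tf hZ hP NH 𝒯 ιX).sec5Stub h).pre.degFr (β hd) : ℕ) * N = N')
  (baseFrob_α : ∀ {N N' : ℕ+} (hd : (N : ℕ) ∣ N'),
    (BiKummerSetting.mkOfConnectedTemperoidYddTower X tf hZ hP NH 𝒯 ιX).IsOfBaseFrobeniusType (α hd))
  -- the Thm. 4.4 data of the self-equivalence `Ψ = h44.Ψ`
  (h44 : BiKummerSetting.Thm44Hyp (BiKummerSetting.mkOfConnectedTemperoidYddTower X tf hZ hP NH 𝒯 ιX)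
    (BiKummerSetting.mkOfConnectedTemperoidYddTower X tf hZ hP NH 𝒯 ιX))
  (ψ : ∀ A : (BiKummerSetting.mkOfConnectedTemperoidYddTower X tf hZ hP NH 𝒯 ιX).C,
    (BiKummerSetting.mkOfConnectedTemperoidYddTower X tf hZ hP NH 𝒯 ιX).biratUnits A ≃*
      (BiKummerSetting.mkOfConnectedTemperoidYddTower X tf hZ hP NH 𝒯 ιX).biratUnits (h44.Ψ.functor.obj A))
  (hpull : ∀ {A A' : (BiKummerSetting.mkOfConnectedTemperoidYddTower X tf hZ hP NH 𝒯 ιX).C} (φ : A' ⟶ A)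
    (f : (BiKummerSetting.mkOfConnectedTemperoidYddTower X tf hZ hP NH 𝒯 ιX).biratUnits A),
      ψ A' (pullFrac φ f) = pullFrac (h44.Ψ.functor.map φ) (ψ A f))
  (hii : BiKummerSetting.Thm44_ii h44 ψ) (h3 : h44.PreservesFrobeniusStructure) (h4b : h44.PreservesBaseFrobeniusTypeData)
  (h8 : h44.PreservesAmple) (h15a : h44.PreservesFixedByHA ψ) (h15 : h44.PreservesSaturated ψ)
  (hpull₂ : ∀ {X' Y Z : (BiKummerSetting.mkOfConnectedTemperoidYddTower X tf hZ hP NH 𝒯 ιX).C} (φ : X' ⟶ Y) (χ : Y ⟶ Z)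
    (g : (BiKummerSetting.mkOfConnectedTemperoidYddTower X tf hZ hP NH 𝒯 ιX).biratUnits Z),
      pullFrac (φ ≫ χ) g = pullFrac φ (pullFrac χ g))
  -- (B1)/(B1′): the Def. 4.1 (iv) datum of each transition `α_{1,N}` and its pull-back compatibility
  (D : ∀ N : ℕ+, (BiKummerSetting.mkOfConnectedTemperoidYddTower X tf hZ hP NH 𝒯 ιX).BaseFrobeniusTypeData (α (one_dvd_level N)))
  (hD : ∀ N : ℕ+, pullFrac (D N).α₁ (R 1).root = pullFrac (R N).αData.α₁ Rl.root)

/-- `deg_Fr(α_{1,N}) = N` from the tower's degree law `deg_Fr(α_{N,N'})·N = N'` at `(1, N)` (copy of the private lemma of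
`Sec5Thm57CoherentFamilyOfRebase.lean`). [cite: MochizukiEtTh2009, Rmk 4.3.2 p.318–319 (PDF pp.92–93)] -/
private theorem degFr_eq_of_one' {d N : ℕ+} (hd : (d : ℕ) * ((1 : ℕ+) : ℕ) = N) : d = N := by
  rw [PNat.one_coe, mul_one] at hd
  exact PNat.coe_inj.mp hd

include comm_sCap comm_sCup isIsometry_α degFr_α isIsometry_β degFr_β hpull hii h3 h4b h8 h15a h15 hpull₂ hD in
/-- **The coherent family at the genuine setting, root-data form — ANCHORED binders** (`hroot`, `hivP'` asked only at the units of
normalised anchors; otherwise abc-iut-w5-d245's `hfam_of_rebase` verbatim): for every NORMALISED ANCHOR `(α₁, β₁, u₁)` at the first root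
`R 1` (`u₁ ∈ O^×(B_1)`, `α₁⁻¹ ≫ Ψ(s^⊓_1) ≫ β₁ = s^⊓_1`, `α₁⁻¹ ≫ Ψ(s^⊔_1) ≫ β₁ = s^⊔_1 ≫ u₁`) and every level `N`: identifications
`a : Ψ(A_N) ⥲ A_N`, `b : Ψ(B_N) ⥲ B_N` and a unit `w ∈ O^×(B_N)` with `a⁻¹ ≫ Ψ(s^⊓_N) ≫ b = s^⊓_N`, `a⁻¹ ≫ Ψ(s^⊔_N) ≫ b = s^⊔_N ≫ w`,
`a⁻¹ ≫ Ψ(α_{1,N}) ≫ α₁ = α_{1,N}`, `b⁻¹ ≫ Ψ(β_{1,N}) ≫ β₁ = β_{1,N}` — abc-iut-f-121's `NthRoot.exists_coherent_family_member_rebase`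
(Prop. 4.2 (iv) at the `u₁`-twisted level-1 pair, applied to the level-`N` root rebased over the level-1 pair) with the tower's
squares, isometries and degrees, `hdisj`/`hdisjN` (`Φ` divisorial), `hfrac := rfl` and "isomorphisms are isometries"
([FrdI] Rem. 1.1.1 at the model) discharged.
[cite: MochizukiEtTh2009, Thm 5.7 p.330 (PDF p.104); Rmk 4.3.2 p.318–319 (PDF pp.92–93); Prop 4.2 (iv) p.315 (PDF p.89)] -/
theorem hfam_of_rebase_anchored
    -- per anchor: Thm. 4.4 (ii) birational compatibility of the anchor at `A_1` with the twisted fraction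
    (hf : ∀ (α₁ : h44.Ψ.functor.obj (R 1).AN ≅ (R 1).AN) (β₁ : h44.Ψ.functor.obj (R 1).BN ≅ (R 1).BN) (u₁ : Aut (R 1).BN)
      (hu₁ : u₁ ∈ (BiKummerSetting.mkOfConnectedTemperoidYddTower X tf hZ hP NH 𝒯 ιX).units (R 1).BN),
      α₁.inv ≫ h44.Ψ.functor.map (R 1).pair.num ≫ β₁.hom = (R 1).pair.num →
      α₁.inv ≫ h44.Ψ.functor.map (R 1).pair.den ≫ β₁.hom = (R 1).pair.den ≫ u₁.hom →
        pullFrac α₁.hom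
          ((BiKummerSetting.mkOfConnectedTemperoidYddTower X tf hZ hP NH 𝒯 ιX).fracOf (R 1).pair.num ((R 1).pair.den ≫ u₁.hom)
            (R 1).pair.isPreStep_num
            ((BiKummerSetting.mkOfConnectedTemperoidYddTower X tf hZ hP NH 𝒯 ιX).isPreStep_comp_aut (R 1).pair.isPreStep_den u₁)
            ((BiKummerSetting.mkOfConnectedTemperoidYddTower X tf hZ hP NH 𝒯 ιX).baseEquivalent_comp_unit (R 1).pair.base_eq hu₁)) =
          ψ (R 1).AN (R 1).root)
    -- per anchor and level: clause (e) pointwise at the anchor, and the base isomorphism of `Ψ` at `A_N` over `α_{1,N}`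
    (hArises : ∀ (α₁ : h44.Ψ.functor.obj (R 1).AN ≅ (R 1).AN) (N : ℕ+),
      (BiKummerSetting.mkOfConnectedTemperoidYddTower X tf hZ hP NH 𝒯 ιX).ArisesFromBaseFrobeniusPair
        ((D N).G.map (h44.Ψ.functor.mapAut (R N).AN)) (h44.Ψ.functor.map (D N).α₂) (h44.Ψ.functor.map (D N).α₁ ≫ α₁.hom))
    (hebs : ∀ (α₁ : h44.Ψ.functor.obj (R 1).AN ≅ (R 1).AN) (N : ℕ+),
      ∃ ebs : (BiKummerSetting.mkOfConnectedTemperoidYddTower X tf hZ hP NH 𝒯 ιX).base.obj (R N).AN ≅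
          (BiKummerSetting.mkOfConnectedTemperoidYddTower X tf hZ hP NH 𝒯 ιX).base.obj (h44.Ψ.functor.obj (R N).AN),
        (BiKummerSetting.mkOfConnectedTemperoidYddTower X tf hZ hP NH 𝒯 ιX).base.map (α (one_dvd_level N)) =
          ebs.hom ≫ (BiKummerSetting.mkOfConnectedTemperoidYddTower X tf hZ hP NH 𝒯 ιX).base.map
            (h44.Ψ.functor.map (α (one_dvd_level N)) ≫ α₁.hom))
    -- per NORMALISED ANCHOR `(α₁, β₁, u₁)` and level (anchored form of abc-iut-L2-d4's `hroot₁N` with its birational clauses)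
    (hroot : ∀ (α₁ : h44.Ψ.functor.obj (R 1).AN ≅ (R 1).AN) (β₁ : h44.Ψ.functor.obj (R 1).BN ≅ (R 1).BN) (u₁ : Aut (R 1).BN)
      (hu₁ : u₁ ∈ (BiKummerSetting.mkOfConnectedTemperoidYddTower X tf hZ hP NH 𝒯 ιX).units (R 1).BN),
      α₁.inv ≫ h44.Ψ.functor.map (R 1).pair.num ≫ β₁.hom = (R 1).pair.num →
      α₁.inv ≫ h44.Ψ.functor.map (R 1).pair.den ≫ β₁.hom = (R 1).pair.den ≫ u₁.hom →
      ∀ (N : ℕ+), ∃ (ut : Aut (R N).BN) (hut : ut ∈ (BiKummerSetting.mkOfConnectedTemperoidYddTower X tf hZ hP NH 𝒯 ιX).units (R N).BN),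
        ut.hom ≫ β (one_dvd_level N) = β (one_dvd_level N) ≫ u₁.hom ∧
        (BiKummerSetting.mkOfConnectedTemperoidYddTower X tf hZ hP NH 𝒯 ιX).fracOf (R N).pair.num ((R N).pair.den ≫ ut.hom)
            (R N).pair.isPreStep_num
            ((BiKummerSetting.mkOfConnectedTemperoidYddTower X tf hZ hP NH 𝒯 ιX).isPreStep_comp_aut (R N).pair.isPreStep_den ut)
            ((BiKummerSetting.mkOfConnectedTemperoidYddTower X tf hZ hP NH 𝒯 ιX).baseEquivalent_comp_unit (R N).pair.base_eq hut) ^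
            (N : ℕ) =
          pullFrac (D N).α₁
            ((BiKummerSetting.mkOfConnectedTemperoidYddTower X tf hZ hP NH 𝒯 ιX).fracOf (R 1).pair.num ((R 1).pair.den ≫ u₁.hom)
              (R 1).pair.isPreStep_num
              ((BiKummerSetting.mkOfConnectedTemperoidYddTower X tf hZ hP NH 𝒯 ιX).isPreStep_comp_aut (R 1).pair.isPreStep_den u₁)
              ((BiKummerSetting.mkOfConnectedTemperoidYddTower X tf hZ hP NH 𝒯 ιX).baseEquivalent_comp_unit (R 1).pair.base_eq
                hu₁)) ∧
        (BiKummerSetting.mkOfConnectedTemperoidYddTower X tf hZ hP NH 𝒯 ιX).IsSaturated (R N).AN N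
          (pullFrac (D N).α₁
            ((BiKummerSetting.mkOfConnectedTemperoidYddTower X tf hZ hP NH 𝒯 ιX).fracOf (R 1).pair.num ((R 1).pair.den ≫ u₁.hom)
              (R 1).pair.isPreStep_num
              ((BiKummerSetting.mkOfConnectedTemperoidYddTower X tf hZ hP NH 𝒯 ιX).isPreStep_comp_aut (R 1).pair.isPreStep_den u₁)
              ((BiKummerSetting.mkOfConnectedTemperoidYddTower X tf hZ hP NH 𝒯 ιX).baseEquivalent_comp_unit (R 1).pair.base_eq
                hu₁))))
    -- Prop. 4.2 (iv) at the `u₁`-twisted level-1 pair, per NORMALISED ANCHOR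
    (hivP' : ∀ (α₁ : h44.Ψ.functor.obj (R 1).AN ≅ (R 1).AN) (β₁ : h44.Ψ.functor.obj (R 1).BN ≅ (R 1).BN) (u₁ : Aut (R 1).BN)
      (hu₁ : u₁ ∈ (BiKummerSetting.mkOfConnectedTemperoidYddTower X tf hZ hP NH 𝒯 ιX).units (R 1).BN),
      α₁.inv ≫ h44.Ψ.functor.map (R 1).pair.num ≫ β₁.hom = (R 1).pair.num →
      α₁.inv ≫ h44.Ψ.functor.map (R 1).pair.den ≫ β₁.hom = (R 1).pair.den ≫ u₁.hom →
      ∀ (N : ℕ+)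
      (R' R'' : (BiKummerSetting.mkOfConnectedTemperoidYddTower X tf hZ hP NH 𝒯 ιX).NthRoot
        ((BiKummerSetting.mkOfConnectedTemperoidYddTower X tf hZ hP NH 𝒯 ιX).fracOf (R 1).pair.num ((R 1).pair.den ≫ u₁.hom)
          (R 1).pair.isPreStep_num
          ((BiKummerSetting.mkOfConnectedTemperoidYddTower X tf hZ hP NH 𝒯 ιX).isPreStep_comp_aut (R 1).pair.isPreStep_den u₁)
          ((BiKummerSetting.mkOfConnectedTemperoidYddTower X tf hZ hP NH 𝒯 ιX).baseEquivalent_comp_unit (R 1).pair.base_eq hu₁))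
        ((R 1).pair.twistUnit u₁ hu₁ rfl
          (BiKummerSetting.disjointSupports_twistUnit h.isDivisorial (R 1).pair u₁)) N pullFrac)
      (ebs : (BiKummerSetting.mkOfConnectedTemperoidYddTower X tf hZ hP NH 𝒯 ιX).base.obj R'.AN ≅
        (BiKummerSetting.mkOfConnectedTemperoidYddTower X tf hZ hP NH 𝒯 ιX).base.obj R''.AN),
      (BiKummerSetting.mkOfConnectedTemperoidYddTower X tf hZ hP NH 𝒯 ιX).base.map R'.α =
        ebs.hom ≫ (BiKummerSetting.mkOfConnectedTemperoidYddTower X tf hZ hP NH 𝒯 ιX).base.map R''.α →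
        ∃ (v : (BiKummerSetting.mkOfConnectedTemperoidYddTower X tf hZ hP NH 𝒯 ιX).mu R'.BN N) (ζA : R'.AN ≅ R''.AN)
          (ζB : R'.BN ≅ R''.BN),
          ζA.hom ≫ R''.pair.num = R'.pair.num ≫ ζB.hom ∧
          ζA.hom ≫ R''.pair.den = (R'.pair.den ≫ (v : Aut R'.BN).hom) ≫ ζB.hom ∧
          ζA.hom ≫ R''.α = R'.α ∧ ζB.hom ≫ R''.β = R'.β ∧
          (BiKummerSetting.mkOfConnectedTemperoidYddTower X tf hZ hP NH 𝒯 ιX).base.mapIso ζA = ebs) :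
    ∀ (α₁ : h44.Ψ.functor.obj (R 1).AN ≅ (R 1).AN) (β₁ : h44.Ψ.functor.obj (R 1).BN ≅ (R 1).BN) (u₁ : Aut (R 1).BN),
      u₁ ∈ (BiKummerSetting.mkOfConnectedTemperoidYddTower X tf hZ hP NH 𝒯 ιX).units (R 1).BN →
      α₁.inv ≫ h44.Ψ.functor.map (R 1).pair.num ≫ β₁.hom = (R 1).pair.num →
      α₁.inv ≫ h44.Ψ.functor.map (R 1).pair.den ≫ β₁.hom = (R 1).pair.den ≫ u₁.hom →
        ∀ N : ℕ+, ∃ (a : h44.Ψ.functor.obj (R N).AN ≅ (R N).AN) (b : h44.Ψ.functor.obj (R N).BN ≅ (R N).BN)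
          (w : Aut (R N).BN),
          w ∈ (BiKummerSetting.mkOfConnectedTemperoidYddTower X tf hZ hP NH 𝒯 ιX).units (R N).BN ∧
          a.inv ≫ h44.Ψ.functor.map (R N).pair.num ≫ b.hom = (R N).pair.num ∧
          a.inv ≫ h44.Ψ.functor.map (R N).pair.den ≫ b.hom = (R N).pair.den ≫ w.hom ∧
          a.inv ≫ h44.Ψ.functor.map (α (one_dvd_level N)) ≫ α₁.hom = α (one_dvd_level N) ∧
          b.inv ≫ h44.Ψ.functor.map (β (one_dvd_level N)) ≫ β₁.hom = β (one_dvd_level N) := by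
  intro α₁ β₁ u₁ hu₁ hnum hden N
  have t1 : Objectwise (fun M _ => IsDivisorial M) (BiKummerSetting.mkOfConnectedTemperoidYddTower X tf hZ hP NH 𝒯 ιX).tf.divisorMonoid := h.isDivisorial
  have t3 : (BiKummerSetting.mkOfConnectedTemperoidYddTower X tf hZ hP NH 𝒯 ιX).IsIsometry (α (one_dvd_level N)) := isIsometry_α (one_dvd_level N)
  have t3b : (BiKummerSetting.mkOfConnectedTemperoidYddTower X tf hZ hP NH 𝒯 ιX).IsIsometry (β (one_dvd_level N)) := isIsometry_β (one_dvd_level N)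
  have hdega : (BiKummerSetting.mkOfConnectedTemperoidYddTower X tf hZ hP NH 𝒯 ιX).degFr (α (one_dvd_level N)) = N := degFr_eq_of_one' (degFr_α (one_dvd_level N))
  have hdegb : (BiKummerSetting.mkOfConnectedTemperoidYddTower X tf hZ hP NH 𝒯 ιX).degFr (β (one_dvd_level N)) = N := degFr_eq_of_one' (degFr_β (one_dvd_level N))
  have hPF := ModelFrobenioid.isPreFrobenioid (DivB := tf.divBNatTrans) h.isMonoidOn h.isDivisorial h.isMonoidOn_rat
    h.isGroupLike_rat h.isGraphConnected h.isTotallyEpimorphic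
  have heA : (BiKummerSetting.mkOfConnectedTemperoidYddTower X tf hZ hP NH 𝒯 ιX).IsIsometry α₁.hom := PreFrobenioid.isIsometry_of_isIso _ hPF α₁.hom
  have heB : (BiKummerSetting.mkOfConnectedTemperoidYddTower X tf hZ hP NH 𝒯 ιX).IsIsometry β₁.hom := PreFrobenioid.isIsometry_of_isIso _ hPF β₁.hom
  obtain ⟨ut, hut, hover, hpow, hsat⟩ := hroot α₁ β₁ u₁ hu₁ hnum hden N
  obtain ⟨ebs, hebsN⟩ := hebs α₁ N
  -- abc-iut-f-121's Prop. 4.2 (iv) at the rebased root, fed in stages (elaboration budget)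
  have stage1 := BiKummerSetting.NthRoot.exists_coherent_family_member_rebase h44 ψ pullFrac hpull hii h3 h4b h8 h15a h15
    (R N) (R 1) (α (one_dvd_level N)) (β (one_dvd_level N)) (comm_sCap (one_dvd_level N)) (comm_sCup (one_dvd_level N))
    t3 t3b hdega hdegb (D N) (hD N) u₁ hu₁ rfl (BiKummerSetting.disjointSupports_twistUnit t1 (R 1).pair u₁) α₁ β₁ hnum hden
  have stage2 := stage1 (hf α₁ β₁ u₁ hu₁ hnum hden) heA heB (hArises α₁ N) hpull₂ ut hut hover rfl
    (BiKummerSetting.disjointSupports_twistUnit t1 (R N).pair ut) hpow hsat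
  exact stage2 (hivP' α₁ β₁ u₁ hu₁ hnum hden N) ebs hebsN

include comm_sCap comm_sCup isIsometry_α degFr_α isIsometry_β degFr_β hpull hii h3 h4b h8 h15a h15 hpull₂ hD in
/-- **FILE 2 of the Thm. 5.7 final knit — ANCHORED binders: the coherent family `hfam` of abc-iut-L2-d4's anchored capstone,
PRODUCED at the genuine connected tower** (abc-iut-w5-d245's `hfam_ofConnectedTemperoidFamily_of_rebase` with `hroot`, `hivP'` asked
only at the units of normalised anchors) `T = ofConnectedTemperoidFamily …` — the statement is EXACTLY the binder `hfam` of
`thetaRootPreservedAll_ofConnectedTemperoidYddFamily_ofAnchored_ofPulledConstants` (p442166) for `Ψ := h44.Ψ` (the tower bound by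
`hT`, instantiate with `rfl`): `hfam_of_rebase` read through the definitional identities `T.AN N = (R N).AN`, `T.sCap N = s^⊓_N`,
`T.sCup N = s^⊔_N`, `T.α = α_{·,·}`, `T.β = β_{·,·}`, `(T.atLevel N).units = O^×`.
[cite: MochizukiEtTh2009, Thm 5.7 p.330 (PDF p.104); Rmk 4.3.2 p.318–319 (PDF pp.92–93); Prop 4.2 (iv) p.315 (PDF p.89)] -/
theorem hfam_ofConnectedTemperoidFamily_of_rebase_anchored
    (T : ThetaFrobenioidTower.{w} (BiKummerSetting.mkOfConnectedTemperoidYddTower X tf hZ hP NH 𝒯 ιX).C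
      (ConnectedPart (BTemp X.Pi)))
    (hT : T = ofConnectedTemperoidFamily h Q odd_l R ιX K' (fun N => (Units.map (tf.ratFnFunctor.map (t N).op).hom).comp c₀)
      hinj hinvc hinvp α β comm_sCap comm_sCup isIsometry_α degFr_α isIsometry_β degFr_β baseFrob_α)
    -- per anchor: Thm. 4.4 (ii) birational compatibility of the anchor at `A_1` with the twisted fraction
    (hf : ∀ (α₁ : h44.Ψ.functor.obj (R 1).AN ≅ (R 1).AN) (β₁ : h44.Ψ.functor.obj (R 1).BN ≅ (R 1).BN) (u₁ : Aut (R 1).BN)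
      (hu₁ : u₁ ∈ (BiKummerSetting.mkOfConnectedTemperoidYddTower X tf hZ hP NH 𝒯 ιX).units (R 1).BN),
      α₁.inv ≫ h44.Ψ.functor.map (R 1).pair.num ≫ β₁.hom = (R 1).pair.num →
      α₁.inv ≫ h44.Ψ.functor.map (R 1).pair.den ≫ β₁.hom = (R 1).pair.den ≫ u₁.hom →
        pullFrac α₁.hom
          ((BiKummerSetting.mkOfConnectedTemperoidYddTower X tf hZ hP NH 𝒯 ιX).fracOf (R 1).pair.num ((R 1).pair.den ≫ u₁.hom)
            (R 1).pair.isPreStep_num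
            ((BiKummerSetting.mkOfConnectedTemperoidYddTower X tf hZ hP NH 𝒯 ιX).isPreStep_comp_aut (R 1).pair.isPreStep_den u₁)
            ((BiKummerSetting.mkOfConnectedTemperoidYddTower X tf hZ hP NH 𝒯 ιX).baseEquivalent_comp_unit (R 1).pair.base_eq hu₁)) =
          ψ (R 1).AN (R 1).root)
    -- per anchor and level: clause (e) pointwise at the anchor, and the base isomorphism of `Ψ` at `A_N` over `α_{1,N}`
    (hArises : ∀ (α₁ : h44.Ψ.functor.obj (R 1).AN ≅ (R 1).AN) (N : ℕ+),
      (BiKummerSetting.mkOfConnectedTemperoidYddTower X tf hZ hP NH 𝒯 ιX).ArisesFromBaseFrobeniusPair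
        ((D N).G.map (h44.Ψ.functor.mapAut (R N).AN)) (h44.Ψ.functor.map (D N).α₂) (h44.Ψ.functor.map (D N).α₁ ≫ α₁.hom))
    (hebs : ∀ (α₁ : h44.Ψ.functor.obj (R 1).AN ≅ (R 1).AN) (N : ℕ+),
      ∃ ebs : (BiKummerSetting.mkOfConnectedTemperoidYddTower X tf hZ hP NH 𝒯 ιX).base.obj (R N).AN ≅
          (BiKummerSetting.mkOfConnectedTemperoidYddTower X tf hZ hP NH 𝒯 ιX).base.obj (h44.Ψ.functor.obj (R N).AN),
        (BiKummerSetting.mkOfConnectedTemperoidYddTower X tf hZ hP NH 𝒯 ιX).base.map (α (one_dvd_level N)) =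
          ebs.hom ≫ (BiKummerSetting.mkOfConnectedTemperoidYddTower X tf hZ hP NH 𝒯 ιX).base.map
            (h44.Ψ.functor.map (α (one_dvd_level N)) ≫ α₁.hom))
    -- per NORMALISED ANCHOR `(α₁, β₁, u₁)` and level (anchored form of abc-iut-L2-d4's `hroot₁N` with its birational clauses)
    (hroot : ∀ (α₁ : h44.Ψ.functor.obj (R 1).AN ≅ (R 1).AN) (β₁ : h44.Ψ.functor.obj (R 1).BN ≅ (R 1).BN) (u₁ : Aut (R 1).BN)
      (hu₁ : u₁ ∈ (BiKummerSetting.mkOfConnectedTemperoidYddTower X tf hZ hP NH 𝒯 ιX).units (R 1).BN),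
      α₁.inv ≫ h44.Ψ.functor.map (R 1).pair.num ≫ β₁.hom = (R 1).pair.num →
      α₁.inv ≫ h44.Ψ.functor.map (R 1).pair.den ≫ β₁.hom = (R 1).pair.den ≫ u₁.hom →
      ∀ (N : ℕ+), ∃ (ut : Aut (R N).BN) (hut : ut ∈ (BiKummerSetting.mkOfConnectedTemperoidYddTower X tf hZ hP NH 𝒯 ιX).units (R N).BN),
        ut.hom ≫ β (one_dvd_level N) = β (one_dvd_level N) ≫ u₁.hom ∧
        (BiKummerSetting.mkOfConnectedTemperoidYddTower X tf hZ hP NH 𝒯 ιX).fracOf (R N).pair.num ((R N).pair.den ≫ ut.hom)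
            (R N).pair.isPreStep_num
            ((BiKummerSetting.mkOfConnectedTemperoidYddTower X tf hZ hP NH 𝒯 ιX).isPreStep_comp_aut (R N).pair.isPreStep_den ut)
            ((BiKummerSetting.mkOfConnectedTemperoidYddTower X tf hZ hP NH 𝒯 ιX).baseEquivalent_comp_unit (R N).pair.base_eq hut) ^
            (N : ℕ) =
          pullFrac (D N).α₁
            ((BiKummerSetting.mkOfConnectedTemperoidYddTower X tf hZ hP NH 𝒯 ιX).fracOf (R 1).pair.num ((R 1).pair.den ≫ u₁.hom)
              (R 1).pair.isPreStep_num
              ((BiKummerSetting.mkOfConnectedTemperoidYddTower X tf hZ hP NH 𝒯 ιX).isPreStep_comp_aut (R 1).pair.isPreStep_den u₁)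
              ((BiKummerSetting.mkOfConnectedTemperoidYddTower X tf hZ hP NH 𝒯 ιX).baseEquivalent_comp_unit (R 1).pair.base_eq
                hu₁)) ∧
        (BiKummerSetting.mkOfConnectedTemperoidYddTower X tf hZ hP NH 𝒯 ιX).IsSaturated (R N).AN N
          (pullFrac (D N).α₁
            ((BiKummerSetting.mkOfConnectedTemperoidYddTower X tf hZ hP NH 𝒯 ιX).fracOf (R 1).pair.num ((R 1).pair.den ≫ u₁.hom)
              (R 1).pair.isPreStep_num
              ((BiKummerSetting.mkOfConnectedTemperoidYddTower X tf hZ hP NH 𝒯 ιX).isPreStep_comp_aut (R 1).pair.isPreStep_den u₁)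
              ((BiKummerSetting.mkOfConnectedTemperoidYddTower X tf hZ hP NH 𝒯 ιX).baseEquivalent_comp_unit (R 1).pair.base_eq
                hu₁))))
    -- Prop. 4.2 (iv) at the `u₁`-twisted level-1 pair, per NORMALISED ANCHOR
    (hivP' : ∀ (α₁ : h44.Ψ.functor.obj (R 1).AN ≅ (R 1).AN) (β₁ : h44.Ψ.functor.obj (R 1).BN ≅ (R 1).BN) (u₁ : Aut (R 1).BN)
      (hu₁ : u₁ ∈ (BiKummerSetting.mkOfConnectedTemperoidYddTower X tf hZ hP NH 𝒯 ιX).units (R 1).BN),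
      α₁.inv ≫ h44.Ψ.functor.map (R 1).pair.num ≫ β₁.hom = (R 1).pair.num →
      α₁.inv ≫ h44.Ψ.functor.map (R 1).pair.den ≫ β₁.hom = (R 1).pair.den ≫ u₁.hom →
      ∀ (N : ℕ+)
      (R' R'' : (BiKummerSetting.mkOfConnectedTemperoidYddTower X tf hZ hP NH 𝒯 ιX).NthRoot
        ((BiKummerSetting.mkOfConnectedTemperoidYddTower X tf hZ hP NH 𝒯 ιX).fracOf (R 1).pair.num ((R 1).pair.den ≫ u₁.hom)
          (R 1).pair.isPreStep_num
          ((BiKummerSetting.mkOfConnectedTemperoidYddTower X tf hZ hP NH 𝒯 ιX).isPreStep_comp_aut (R 1).pair.isPreStep_den u₁)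
          ((BiKummerSetting.mkOfConnectedTemperoidYddTower X tf hZ hP NH 𝒯 ιX).baseEquivalent_comp_unit (R 1).pair.base_eq hu₁))
        ((R 1).pair.twistUnit u₁ hu₁ rfl
          (BiKummerSetting.disjointSupports_twistUnit h.isDivisorial (R 1).pair u₁)) N pullFrac)
      (ebs : (BiKummerSetting.mkOfConnectedTemperoidYddTower X tf hZ hP NH 𝒯 ιX).base.obj R'.AN ≅
        (BiKummerSetting.mkOfConnectedTemperoidYddTower X tf hZ hP NH 𝒯 ιX).base.obj R''.AN),
      (BiKummerSetting.mkOfConnectedTemperoidYddTower X tf hZ hP NH 𝒯 ιX).base.map R'.α =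
        ebs.hom ≫ (BiKummerSetting.mkOfConnectedTemperoidYddTower X tf hZ hP NH 𝒯 ιX).base.map R''.α →
        ∃ (v : (BiKummerSetting.mkOfConnectedTemperoidYddTower X tf hZ hP NH 𝒯 ιX).mu R'.BN N) (ζA : R'.AN ≅ R''.AN)
          (ζB : R'.BN ≅ R''.BN),
          ζA.hom ≫ R''.pair.num = R'.pair.num ≫ ζB.hom ∧
          ζA.hom ≫ R''.pair.den = (R'.pair.den ≫ (v : Aut R'.BN).hom) ≫ ζB.hom ∧
          ζA.hom ≫ R''.α = R'.α ∧ ζB.hom ≫ R''.β = R'.β ∧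
          (BiKummerSetting.mkOfConnectedTemperoidYddTower X tf hZ hP NH 𝒯 ιX).base.mapIso ζA = ebs) :
    ∀ (α₁ : h44.Ψ.functor.obj (T.AN 1) ≅ T.AN 1) (β₁ : h44.Ψ.functor.obj (T.BN 1) ≅ T.BN 1) (u₁ : Aut (T.BN 1)),
      u₁ ∈ (T.atLevel 1).units (T.BN 1) →
      α₁.inv ≫ h44.Ψ.functor.map (T.sCap 1) ≫ β₁.hom = T.sCap 1 →
      α₁.inv ≫ h44.Ψ.functor.map (T.sCup 1) ≫ β₁.hom = T.sCup 1 ≫ u₁.hom →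
        ∀ N : ℕ+, ∃ (a : h44.Ψ.functor.obj (T.AN N) ≅ T.AN N) (b : h44.Ψ.functor.obj (T.BN N) ≅ T.BN N) (w : Aut (T.BN N)),
          w ∈ (T.atLevel N).units (T.BN N) ∧
          a.inv ≫ h44.Ψ.functor.map (T.sCap N) ≫ b.hom = T.sCap N ∧
          a.inv ≫ h44.Ψ.functor.map (T.sCup N) ≫ b.hom = T.sCup N ≫ w.hom ∧
          a.inv ≫ h44.Ψ.functor.map (T.α (one_dvd_level N)) ≫ α₁.hom = T.α (one_dvd_level N) ∧
          b.inv ≫ h44.Ψ.functor.map (T.β (one_dvd_level N)) ≫ β₁.hom = T.β (one_dvd_level N) := by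
  subst hT
  intro α₁ β₁ u₁ hu₁ hnum hden N
  exact hfam_of_rebase_anchored 𝒯 ιX h R α β comm_sCap comm_sCup isIsometry_α degFr_α isIsometry_β degFr_β h44 ψ hpull hii h3
    h4b h8 h15a h15 hpull₂ D hD hf hArises hebs hroot hivP' α₁ β₁ u₁ hu₁ hnum hden N

end ThetaFrobenioidTower

end Literature.AnabelianGeometry.EtaleTheta

end
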